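import Mathlib.RingTheory.Frobenius
import Literature.NumberTheory.Automorphic.GaloisActionPlaces
import HarnessLib

/-!
# A Frobenius element raises roots of unity of order prime to `𝔓` to the `q`-th power
# (Shimura 1998, §18.6 proof, p. 128; Serre, *Corps locaux*, II §4 Prop. 8)

Topic `Literature/NumberTheory/NumberFields`, namespace `Literature.NumberTheory.NumberFields`.  Theorems only (no
definition, no named fact; net Literature debt **0**).  Written for the cell `hodgecm-mathlib` (D-0151), fan B-II,
line `b2-main-theorem-cm` v2, stub S5 (polarisation transport), divisor-free route: the level Weil pairing of two
`L`-rational torsion points is a root of unity `ζ ∈ L` of `ℓ`-power order, and the Frobenius element `γ = [𝔓, L/K*]`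
acts on it by `γ ζ = ζ^q`, `q = N(𝔓 ∩ K*)`.

## Sources

* J.-P. Serre, *Corps locaux* / *Local Fields* [SerreLocalFields1979], Ch. II §4, Prop. 8: the roots of unity of
  order prime to the residue characteristic map injectively to the residue field (uniqueness of the multiplicative
  representative).  The tree has the valuation-ring form
  `Literature.AnabelianGeometry.AbsoluteAnabelian.eq_one_of_pow_eq_one_of_sub_one_mem_maximalIdeal`
  (`MLFResidueCardBridgeProofs`); here the same computation (`η^N − 1 = (η − 1) Σ η^i`, `Σ η^i ≡ N`) is run for a prime
  ideal of a domain not containing `N`.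
* G. Shimura, *Abelian Varieties with Complex Multiplication and Modular Functions* [Shimura1998], §18.6 proof of
  Thm. 18.6, p. 128: the comparison of `X^σ` with `pX` through the reduction modulo `𝔓` (`σ = [𝔓, L/K*]`), whose
  Weil-pairing form reads `ē^{X^σ}(t^σ, s^σ) = σ(ē^X(t, s)) = ē^X(t, s)^q`.

## What is here

* `eq_one_of_pow_eq_one_of_sub_one_mem` — in a domain `R` with a prime ideal `I ∌ N`: `η^N = 1`, `η ≡ 1 (mod I)` ⇒
  `η = 1`; `eq_of_pow_eq_one_of_sub_mem` — two `N`-th roots of unity congruent mod `I` are equal.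
* `RingOfIntegers.smul_eq_pow_of_isArithFrobAt` — for `γ : K ≃ₐ[F₀] K` an arithmetic Frobenius at a prime `v` of
  `𝓞 K` (Mathlib `IsArithFrobAt (𝓞 F₀) γ v`) and `ζ ∈ 𝓞 K` with `ζ^N = 1`, `N ∉ v`: **`γ • ζ = ζ^q`**,
  `q = #(𝓞 F₀ ⧸ v ∩ 𝓞 F₀)`; the `ℓ`-power form `…_of_pow_prime_pow_eq_one` (`ℓ ∉ v`); and the field-level form
  `algEquiv_apply_eq_pow_of_pow_eq_one` for `x : K` with `x^N = 1`.

## References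

* [SerreLocalFields1979] J.-P. Serre, *Local Fields*, GTM 67, Ch. II §4, Prop. 8.
* [Shimura1998] G. Shimura, *Abelian Varieties with Complex Multiplication and Modular Functions*, §18.6 proof of
  Thm. 18.6, p. 128.
-/

namespace Literature.NumberTheory.NumberFields

open NumberField IsDedekindDomain

/-! ### Roots of unity of order prime to a prime ideal are distinct modulo it -/

section Domain

variable {R : Type*} [CommRing R] [IsDomain R] {I : Ideal R}

/-- **A root of unity of order prime to `I` which is `≡ 1 (mod I)` is `1`** (`R` a domain, `I` an ideal with
`N ∉ I`, `η^N = 1`, `η - 1 ∈ I`): `η^N - 1 = (η - 1)·Σ_{i<N} η^i` and `Σ η^i ≡ N (mod I)` (Serre, *Local Fields*,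
II §4 Prop. 8). [cite: SerreLocalFields1979, Ch. II §4 Prop. 8] -/
theorem eq_one_of_pow_eq_one_of_sub_one_mem {N : ℕ} (hN : (N : R) ∉ I) {η : R} (hη : η ^ N = 1)
    (h1 : η - 1 ∈ I) : η = 1 := by
  by_contra hne
  set s : R := ∑ i ∈ Finset.range N, η ^ i with hs
  -- `s ≡ N (mod I)`
  have hsN : s - (N : R) ∈ I := by
    have : s - (N : R) = ∑ i ∈ Finset.range N, (η ^ i - 1) := by
      rw [Finset.sum_sub_distrib, Finset.sum_const, Finset.card_range, nsmul_eq_mul, mul_one]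
    rw [this]
    refine Ideal.sum_mem _ fun i _ => ?_
    obtain ⟨c, hc⟩ := sub_one_dvd_pow_sub_one η i
    rw [hc]
    exact Ideal.mul_mem_right _ _ h1
  -- `s · (η - 1) = η^N - 1 = 0`, and `η - 1 ≠ 0`, so `s = 0`, so `N ∈ I`
  have hprod : s * (η - 1) = 0 := by rw [hs, geom_sum_mul, hη, sub_self]
  have hs0 : s = 0 := (mul_eq_zero.mp hprod).resolve_right (sub_ne_zero.mpr hne)
  rw [hs0, zero_sub] at hsN
  exact hN (by simpa using I.neg_mem_iff.mp hsN)

/-- **Two `N`-th roots of unity congruent modulo `I ∌ N` are equal** (Serre, *Local Fields*, II §4 Prop. 8).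
[cite: SerreLocalFields1979, Ch. II §4 Prop. 8] -/
theorem eq_of_pow_eq_one_of_sub_mem {N : ℕ} (hN : (N : R) ∉ I) {η₁ η₂ : R} (hη₁ : η₁ ^ N = 1)
    (hη₂ : η₂ ^ N = 1) (h : η₁ - η₂ ∈ I) : η₁ = η₂ := by
  have hN0 : N ≠ 0 := by
    rintro rfl
    exact hN (by simp)
  obtain ⟨m, rfl⟩ := Nat.exists_eq_succ_of_ne_zero hN0
  -- `u = η₂^{N-1}` is the inverse of `η₂`
  have hinv : η₂ * η₂ ^ m = 1 := by rw [← pow_succ']; exact hη₂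
  have hη : (η₁ * η₂ ^ m) ^ m.succ = 1 := by
    rw [mul_pow, ← pow_mul, mul_comm m m.succ, pow_mul, hη₁, hη₂, one_pow, one_mul]
  have h1 : η₁ * η₂ ^ m - 1 ∈ I := by
    have : η₁ * η₂ ^ m - 1 = (η₁ - η₂) * η₂ ^ m := by rw [sub_mul, hinv]
    rw [this]
    exact Ideal.mul_mem_right _ _ h
  have := eq_one_of_pow_eq_one_of_sub_one_mem hN hη h1
  calc η₁ = η₁ * (η₂ * η₂ ^ m) := by rw [hinv, mul_one]
    _ = η₁ * η₂ ^ m * η₂ := by ring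
    _ = η₂ := by rw [this, one_mul]

end Domain

/-! ### Frobenius elements on roots of unity in a number field -/

section Frobenius

variable {F₀ K : Type} [Field F₀] [Field K] [Algebra F₀ K]
  (v : HeightOneSpectrum (𝓞 K)) (γ : K ≃ₐ[F₀] K)

/-- **A Frobenius element raises roots of unity of order prime to `v` to the `q`-th power**: for
`γ ∈ Aut(K/F₀)` with `γ x ≡ x^q (mod v)` on `𝓞 K` (`IsArithFrobAt (𝓞 F₀) γ v`, `q = #(𝓞 F₀ / v ∩ 𝓞 F₀)`) and
`ζ ∈ 𝓞 K` with `ζ^N = 1`, `N ∉ v`: `γ • ζ = ζ^q` (both are `N`-th roots of unity, congruent mod `v`) — the sentence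
«`σ(e(t, s)) = e(t, s)^q`» of the reduction step of Shimura's proof of Thm. 18.6.
[cite: Shimura1998, §18.6 proof of Thm. 18.6, p. 128] -/
theorem RingOfIntegers.smul_eq_pow_of_isArithFrobAt (hγ : IsArithFrobAt (𝓞 F₀) γ v.asIdeal) {N : ℕ}
    (hN : (N : 𝓞 K) ∉ v.asIdeal) {ζ : 𝓞 K} (hζ : ζ ^ N = 1) :
    γ • ζ = ζ ^ Nat.card (𝓞 F₀ ⧸ v.asIdeal.under (𝓞 F₀)) := by
  haveI := v.isPrime
  refine eq_of_pow_eq_one_of_sub_mem hN ?_ ?_ (hγ ζ)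
  · rw [← smul_pow', hζ, smul_one]
  · rw [← pow_mul, mul_comm, pow_mul, hζ, one_pow]

/-- The `ℓ`-power form: `γ • ζ = ζ^q` for `ζ^{ℓ^k} = 1` and `ℓ ∉ v` (the level Weil pairings of Shimura's proof take
values in `ℓ`-power roots of unity, `𝔓 ∤ ℓ M`). [cite: Shimura1998, §18.6 proof of Thm. 18.6, p. 128] -/
theorem RingOfIntegers.smul_eq_pow_of_isArithFrobAt_of_pow_prime_pow_eq_one
    (hγ : IsArithFrobAt (𝓞 F₀) γ v.asIdeal) {ℓ : ℕ} (hℓ : (ℓ : 𝓞 K) ∉ v.asIdeal) {k : ℕ} {ζ : 𝓞 K}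
    (hζ : ζ ^ ℓ ^ k = 1) : γ • ζ = ζ ^ Nat.card (𝓞 F₀ ⧸ v.asIdeal.under (𝓞 F₀)) := by
  haveI := v.isPrime
  refine RingOfIntegers.smul_eq_pow_of_isArithFrobAt v γ hγ (N := ℓ ^ k) ?_ hζ
  rw [Nat.cast_pow]
  exact fun h => hℓ (Ideal.IsPrime.mem_of_pow_mem inferInstance k h)

/-- **Field-level form**: for `x ∈ K` with `x^N = 1`, `N ∉ v` (as an element of `𝓞 K`), a Frobenius `γ` at `v`
satisfies `γ x = x^q` (a root of unity is integral, and `(γ • ζ : 𝓞 K) = γ ζ` in `K`).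
[cite: Shimura1998, §18.6 proof of Thm. 18.6, p. 128] -/
theorem algEquiv_apply_eq_pow_of_pow_eq_one (hγ : IsArithFrobAt (𝓞 F₀) γ v.asIdeal) {N : ℕ} (hN0 : 0 < N)
    (hN : (N : 𝓞 K) ∉ v.asIdeal) {x : K} (hx : x ^ N = 1) :
    γ x = x ^ Nat.card (𝓞 F₀ ⧸ v.asIdeal.under (𝓞 F₀)) := by
  have hint : IsIntegral ℤ x := IsIntegral.of_pow hN0 (by rw [hx]; exact isIntegral_one)
  let ζ : 𝓞 K := ⟨x, hint⟩
  have hζ : ζ ^ N = 1 := by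
    apply RingOfIntegers.ext
    change x ^ N = 1
    exact hx
  have h := RingOfIntegers.smul_eq_pow_of_isArithFrobAt v γ hγ hN hζ
  have h' : ((γ • ζ : 𝓞 K) : K) = ((ζ ^ Nat.card (𝓞 F₀ ⧸ v.asIdeal.under (𝓞 F₀)) : 𝓞 K) : K) :=
    congrArg (fun z : 𝓞 K => (z : K)) h
  rw [Literature.NumberTheory.Automorphic.RingOfIntegers.coe_algEquiv_smul, RingOfIntegers.coe_eq_algebraMap,
    RingOfIntegers.coe_eq_algebraMap, map_pow] at h'
  exact h'

end Frobenius

end Literature.NumberTheory.NumberFields
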